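import Summits.QuantumFields.YangMills.Theorems.LuscherReductionTraceDoorBasics
import Summits.QuantumFields.YangMills.Theorems.LuscherReductionTraceDoorEnclosure
import Summits.QuantumFields.YangMills.Theorems.LuscherReductionRunningReductionKTDoorR3
import Summits.QuantumFields.YangMills.Theorems.LuscherReductionOneSiteLevelsVariational
import Summits.QuantumFields.YangMills.Theorems.FemtoTransferGapBounds
import HarnessLib

/-!
# `TraceDoorGlue` (stmt-QuantumFields-20206) landing — KT COMPOSITION: `CoarseNoIntruder → DressedRitz → RunningReduction` (skeleton PART 3 §5)

Route `LuscherReduction` (owner ym-beyond-p1), RED `RunningReduction` (stmt-QuantumFields-19978) split (route rev 11/12) along the TT door of the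
registered skeleton «KTR» rev 8 (`pub/ym-beyond/p1-g19-files/Lines-KTR-r8.lean`, sha16 4d4e029b06d8e70b); glue item `TraceDoorGlue`
(stmt-QuantumFields-20206) = `TraceFormula → TwistedTraceScaling → OneSiteTail → DressedRitz → RunningReduction`, landed under `Theorems/` as the
file family `LuscherReductionTraceDoor{Defs,Enclosure,Basics,InvAtoms,KT,InvPrep,OST,Glue}.lean` (namespace `…Theorems.FemtoTransferGap.TraceDoor`),
skeleton parts re-homed VERBATIM with the four children taken as the ROUTE DECLS (hypotheses), the skeleton's `Prop` currencies
(`CoarseNoIntruder`, `OneSiteLowerCoarse`, `CoarseLevels`, `OneSiteTraceLimit`) spelled out as texts, the door / Ritz basics / `LevelGapSummable` / ONE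
taken from the tree (`KTDoorR3.katoTempleDoorR3`, `KTDoorR3.ritzBasicsR3`, `LGS.levelGapSummable_all`, `oneSiteLevels_proof`).

THIS FILE: `runningReduction_of_coarseNoIntruder` — the enclosure composition of the KT door (skeleton `KT.RunningReduction_of_KT`) with its
three proved inputs fed from the tree: the Kato–Temple door `KTDoorR3.katoTempleDoorR3` (p486020), the Ritz basics `KTDoorR3.ritzBasicsR3`, and
the coarse one-site lower law `TraceDoor.oneSiteLowerCoarse` (⇐ `oneSiteLevels_proof`); remaining hypotheses = the text of `CoarseNoIntruder`
(Lüscher's law from below with `o(1)` relative error — supplied by the TT door through `coarseNoIntruder_of_coarseLevels ∘ traceInversion`) and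
the route child `Theses.LuscherReduction.DressedRitz` (stmt-QuantumFields-20205, rev-3 residual-Gram form) BY NAME.

HONEST FRAMING: femto rung R2b1 (`FemtoGapOfRecord`) bookkeeping — the XL content (`TwistedTraceScaling`, `DressedRitz`) is ASSUMED, not proved;
nothing here bears on infinite volume, the continuum limit or the Clay mass gap.  Sorry-free, no new definitions.
-/

set_option autoImplicit false

noncomputable section

open MeasureTheory Filter Topology Real
open Literature.MathematicalPhysics.QuantumFieldTheory hiding SU2
open Literature.MathematicalPhysics.QuantumLattice
open Literature.Analysis.OperatorTheory.YMMatrixModel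
open scoped BigOperators

namespace Summit.QuantumFields.YangMills.Theorems.FemtoTransferGap.TraceDoor

open Summit.QuantumFields.YangMills.Theorems.FemtoTransferGap
open Summit.QuantumFields.YangMills.Theorems.FemtoTransferGap.TT (physTrace)

/-- ★ **KT composition (skeleton «KTR» PART 3 §5 `RunningReduction_of_KT`, REAL proof re-homed): `CoarseNoIntruder` + the route child
`DressedRitz` ⟹ RED `RunningReduction` BY NAME.**  The door (`KTDoorR3.katoTempleDoorR3`, residual-Gram Kato–Temple–Lehmann cluster bound),
Rayleigh–Ritz ≤ min–max (`KTDoorR3.ritzBasicsR3`) and the coarse one-site lower law (`oneSiteLowerCoarse`, from the closed crux ONE) are TREE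
THEOREMS fed in at the top; the body is the skeleton's VERBATIM: shell end `k'` of level `k` (`shellsClose`), coarse no-intruder at `k'+1`,
dressed Ritz family at `k'` with `η = g/16`, window scale, top capture through `levelValue_zero_le_of_forall_rayleigh_le`, the door in
implication form, sharp Ritz ratios weakened from `C_R` to `C₁ = max C_R 1`, smallness, and the `enclosure` algebra at `j = k` and `k'`.
[cite: Kato1949, Lemma 2, Thm 1] [cite: Luscher1983, §3] [cite: ReedSimonIV1978, Thm. XIII.1–2] -/
theorem runningReduction_of_coarseNoIntruder
    (hCO : (∀ k : ℕ, ∀ d : ℝ, d < levelGap k → ∃ lam0 : ℝ, 0 < lam0 ∧ ∀ lam : ℝ, 0 < lam → lam ≤ lam0 →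
      ∃ L0 : ℕ, ∀ (L : ℕ) [NeZero L], L0 ≤ L → ∀ β : ℝ, InFemtoWindow lam β L →
        levelValue su2Rep L β k ≤ Real.exp (-(d * luscherLambda β L) / L) * levelValue su2Rep L β 0))
    (hDR : Summit.QuantumFields.YangMills.Theses.LuscherReduction.DressedRitz) :
    Summit.QuantumFields.YangMills.Theses.LuscherReduction.RunningReduction := by
  have hKT := Summit.QuantumFields.YangMills.Theorems.FemtoTransferGap.KTDoorR3.katoTempleDoorR3
  have hRB := Summit.QuantumFields.YangMills.Theorems.FemtoTransferGap.KTDoorR3.ritzBasicsR3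
  have hLOW := oneSiteLowerCoarse
  intro k
  -- shell end `k'` of level `k`
  obtain ⟨k', hkk', hgap⟩ := shellsClose k
  set Dk : ℝ := levelGap k' with hDkdef
  set g : ℝ := levelGap (k' + 1) - levelGap k' with hgdef
  have hg : 0 < g := by rw [hgdef]; linarith
  have hDk0 : 0 ≤ Dk := levelGap_nonneg k'
  have hd : Dk + g / 2 < levelGap (k' + 1) := by rw [hDkdef, hgdef]; linarith
  obtain ⟨lamC, hlamC, hC⟩ := hCO (k' + 1) (Dk + g / 2) hd
  have hη : (0 : ℝ) < g / 16 := div_pos hg (by norm_num)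
  obtain ⟨CR, lamR, hlamR, hR⟩ := hDR k' (g / 16) hη
  set C1 : ℝ := max CR 1 with hC1def
  have hC1 : 1 ≤ C1 := le_max_right _ _
  have hCR : CR ≤ C1 := le_max_left _ _
  have hC1pos : 0 < C1 := one_pos.trans_le hC1
  set A : ℝ := 4 * C1 / g * Real.exp (2 * (Dk + g / 2)) with hAdef
  set E : ℝ := Real.exp (2 * (Dk + g)) with hEdef
  set Cf : ℝ := C1 + A * E + 2 * A with hCfdef
  have hA0 : 0 ≤ A := by
    rw [hAdef]; exact mul_nonneg (div_nonneg (by linarith) hg.le) (Real.exp_pos _).le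
  obtain ⟨B0, hB0⟩ := hLOW k' (g / 16) hη
  -- the window scale
  have hq1 : 0 < g / (16 * C1) := div_pos hg (by positivity)
  have hq2 : 0 < 1 / (8 * (A + 1)) := div_pos one_pos (by positivity)
  refine ⟨Cf, min (min lamC lamR) (min 1 (min (g / (16 * C1)) (1 / (8 * (A + 1))))),
    lt_min (lt_min hlamC hlamR) (lt_min one_pos (lt_min hq1 hq2)), fun lam hlam hlamle => ?_⟩
  have hlamC' : lam ≤ lamC := hlamle.trans ((min_le_left _ _).trans (min_le_left _ _))
  have hlamR' : lam ≤ lamR := hlamle.trans ((min_le_left _ _).trans (min_le_right _ _))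
  have hlam1 : lam ≤ 1 := hlamle.trans ((min_le_right _ _).trans (min_le_left _ _))
  have hlamg : lam ≤ g / (16 * C1) :=
    hlamle.trans ((min_le_right _ _).trans ((min_le_right _ _).trans (min_le_left _ _)))
  have hlamA : lam ≤ 1 / (8 * (A + 1)) :=
    hlamle.trans ((min_le_right _ _).trans ((min_le_right _ _).trans (min_le_right _ _)))
  obtain ⟨L0C, hL0C⟩ := hC lam hlam hlamC'
  obtain ⟨L0R, hL0R⟩ := hR lam hlam hlamR'
  set B0' : ℝ := max B0 1 with hB0'def
  have hB0'pos : 0 < B0' := lt_of_lt_of_le one_pos (le_max_right _ _)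
  refine ⟨max (max L0C L0R) (⌈4 * lam ^ 3 * B0'⌉₊ + 1), fun L _ hL β hW => ?_⟩
  have hLC : L0C ≤ L := ((le_max_left _ _).trans (le_max_left _ _)).trans hL
  have hLR : L0R ≤ L := ((le_max_right _ _).trans (le_max_left _ _)).trans hL
  have hLB : ⌈4 * lam ^ 3 * B0'⌉₊ + 1 ≤ L := (le_max_right _ _).trans hL
  obtain ⟨hβ, hlamle', hlam2⟩ := hW
  -- fine-lattice data: coarse no-intruder at `k'+1`, diagonal dressed Ritz family at `k'`, Ritz basics
  have hcoarse := hL0C L hLC β ⟨hβ, hlamle', hlam2⟩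
  obtain ⟨φ, hφphys, hφon, hφdiag, hφanti, hratio, hres, hcap⟩ := hL0R L hLR β ⟨hβ, hlamle', hlam2⟩
  have hritzle := hRB L β (k' + 1) φ hβ hφphys hφon hφdiag hφanti
  have hmnn : ∀ i, 0 ≤ qform su2Rep β (φ i) (φ i) := fun i => ritz_nonneg hβ (hφphys i)
  have hl0 : 0 < levelValue su2Rep L β 0 := levelValue_zero_su2Rep_pos L β
  have hkk'1 : k < k' + 1 := Nat.lt_succ_of_le hkk'
  -- the Ritz numbers `m₀`, `m_k` (at the Fin index `⟨k, _⟩`) and `m_{k'}` (at `Fin.last k'`)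
  set m0 : ℝ := qform su2Rep β (φ 0) (φ 0) with hm0def
  set mk : ℝ := qform su2Rep β (φ (Fin.last k')) (φ (Fin.last k')) with hmkdef
  have hm0nn : 0 ≤ m0 := hmnn 0
  have hm0le : m0 ≤ levelValue su2Rep L β 0 := by simpa using hritzle 0
  -- scales `l = λ`, `x = λ/L`
  set l : ℝ := luscherLambda β L with hldef
  have hlpos : 0 < l := hlam.trans_le hlamle'
  have hLpos : (0 : ℝ) < L := Nat.cast_pos.mpr (NeZero.pos L)
  have hL1 : (1 : ℝ) ≤ L := by exact_mod_cast NeZero.one_le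
  set x : ℝ := l / L with hxdef
  have hxpos : 0 < x := div_pos hlpos hLpos
  have hxl : x ≤ l := div_le_self hlpos.le hL1
  have hl2 : l ≤ 2 := by linarith only [hlam2, hlam1]
  have hx2 : x ≤ 2 := hxl.trans hl2
  -- the effective one-site coupling
  set B : ℝ := oneSiteCoupling β L with hBdef
  have hBge : B0' ≤ B := by
    have hLreal : 4 * lam ^ 3 * B0' + 1 ≤ (L : ℝ) := by
      have h1 : (4 * lam ^ 3 * B0' : ℝ) ≤ ⌈4 * lam ^ 3 * B0'⌉₊ := Nat.le_ceil _
      have h2 : ((⌈4 * lam ^ 3 * B0'⌉₊ + 1 : ℕ) : ℝ) ≤ L := by exact_mod_cast hLB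
      push_cast at h2
      linarith only [h1, h2]
    have hl3 : l ^ 3 ≤ 8 * lam ^ 3 := by
      calc l ^ 3 ≤ (2 * lam) ^ 3 := pow_le_pow_left₀ hlpos.le hlam2 3
        _ = 8 * lam ^ 3 := by ring
    have hl3pos : 0 < l ^ 3 := pow_pos hlpos 3
    rw [hBdef, oneSiteCoupling, ← hldef, le_div_iff₀ hl3pos]
    have hL3 : (L : ℝ) ≤ (L : ℝ) ^ 3 := by
      have h1sq : (1 : ℝ) ≤ (L : ℝ) ^ 2 := by nlinarith only [hL1]
      calc (L : ℝ) = L * 1 := by ring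
        _ ≤ L * (L : ℝ) ^ 2 := mul_le_mul_of_nonneg_left h1sq hLpos.le
        _ = (L : ℝ) ^ 3 := by ring
    have h5 : B0' * l ^ 3 ≤ B0' * (8 * lam ^ 3) := mul_le_mul_of_nonneg_left hl3 hB0'pos.le
    have h6 : B0' * (8 * lam ^ 3) = 2 * (4 * lam ^ 3 * B0') := by ring
    have h7 : 2 * (4 * lam ^ 3 * B0') ≤ 2 * (L : ℝ) ^ 3 := by linarith only [hLreal, hL3]
    linarith only [h5, h6, h7]
  have hB0le : B0 ≤ B := (le_max_left _ _).trans hBge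
  have hB1 : 1 ≤ B := (le_max_right _ _).trans hBge
  have hbl : bareLambda B = x := by rw [hBdef, hxdef, hldef]; exact bareLambda_oneSiteCoupling hlpos
  -- one-site data
  obtain ⟨hmu0, hlowj⟩ := hB0 B hB0le
  have hmunn : ∀ j : ℕ, 0 ≤ levelValue su2Rep 1 B j := fun j => transferValuesNonneg 1 B j hB1
  -- unit conversions
  have e_lx : CR * l ^ 2 / (L : ℝ) = CR * (l * x) := by rw [hxdef]; ring
  have e_l3 : l ^ 3 / (L : ℝ) ^ 2 = l * x ^ 2 := by rw [hxdef]; ring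
  have e_eta : g / 16 * l / (L : ℝ) = g / 16 * x := by rw [hxdef]; ring
  have e_d : -((Dk + g / 2) * l) / (L : ℝ) = -((Dk + g / 2) * x) := by rw [hxdef]; ring
  -- top capture through the min–max door lemma
  have hcap' : levelValue su2Rep L β 0 ≤ Real.exp (g / 16 * x) * m0 := by
    refine levelValue_zero_le_of_forall_rayleigh_le su2Rep β (mul_nonneg (Real.exp_pos _).le hm0nn) fun ψ hψ _ => ?_
    have h1 := hcap ψ hψ
    rw [e_eta] at h1
    exact h1
  -- the door's residual Gram hypothesis with `ϱ = C₁ (λ³/L²) m₀²` (only the constant is weakened, `C_R ≤ C₁`)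
  set ρ : ℝ := C1 * (l * x ^ 2) * m0 ^ 2 with hρdef
  have hlx2 : 0 ≤ l * x ^ 2 := mul_nonneg hlpos.le (sq_nonneg _)
  have hρnn : 0 ≤ ρ := by rw [hρdef]; exact mul_nonneg (mul_nonneg hC1pos.le hlx2) (sq_nonneg _)
  have hres' : ∀ c : Fin (k' + 1) → ℝ,
      l2 (∑ i, c i • (transferApply β (φ i) - qform su2Rep β (φ i) (φ i) • φ i))
         (∑ i, c i • (transferApply β (φ i) - qform su2Rep β (φ i) (φ i) • φ i)) ≤ ρ * ∑ i, c i ^ 2 := by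
    intro c
    have h1 := hres c
    rw [e_l3] at h1
    have hc2 : 0 ≤ ∑ i, c i ^ 2 := Finset.sum_nonneg fun i _ => sq_nonneg (c i)
    have hCC : CR * (l * x ^ 2) * m0 ^ 2 ≤ C1 * (l * x ^ 2) * m0 ^ 2 :=
      mul_le_mul_of_nonneg_right (mul_le_mul_of_nonneg_right hCR hlx2) (sq_nonneg _)
    calc _ ≤ CR * (l * x ^ 2) * m0 ^ 2 * ∑ i, c i ^ 2 := h1
      _ ≤ C1 * (l * x ^ 2) * m0 ^ 2 * ∑ i, c i ^ 2 := mul_le_mul_of_nonneg_right hCC hc2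
      _ = ρ * ∑ i, c i ^ 2 := by rw [hρdef]
  -- the door (in implication form): every Ritz number controls its level
  set θ : ℝ := Real.exp (-((Dk + g / 2) * l) / L) * levelValue su2Rep L β 0 with hθdef
  have hdoor : θ < mk → ∀ j : Fin (k' + 1),
      levelValue su2Rep L β j ≤ qform su2Rep β (φ j) (φ j) + ρ / (mk - θ) :=
    fun hθlt => hKT L β k' φ θ ρ hβ hφphys hφon hφdiag hφanti hcoarse hθlt hρnn hres'
  have hdoor0 : θ < mk → levelValue su2Rep L β 0 ≤ m0 + ρ / (mk - θ) := fun hθlt => by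
    simpa using hdoor hθlt 0
  -- sharp Ritz ratios, weakened from `C_R` to `C₁`
  have hratio' : ∀ j : Fin (k' + 1),
      qform su2Rep β (φ j) (φ j) * levelValue su2Rep 1 B 0 ≤
          Real.exp (C1 * (l * x)) * (levelValue su2Rep 1 B j * m0) ∧
        levelValue su2Rep 1 B j * m0 ≤ Real.exp (C1 * (l * x)) * (qform su2Rep β (φ j) (φ j) * levelValue su2Rep 1 B 0) := by
    intro j
    obtain ⟨ha, hb⟩ := hratio j
    rw [e_lx] at ha hb
    have hexp : Real.exp (CR * (l * x)) ≤ Real.exp (C1 * (l * x)) :=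
      Real.exp_le_exp.mpr (mul_le_mul_of_nonneg_right hCR (mul_pos hlpos hxpos).le)
    exact ⟨ha.trans (mul_le_mul_of_nonneg_right hexp (mul_nonneg (hmunn j) hm0nn)),
      hb.trans (mul_le_mul_of_nonneg_right hexp (mul_nonneg (hmnn j) hmu0.le))⟩
  -- smallness
  have hs1 : C1 * l ≤ g / 8 := by
    have h1 : l ≤ 2 * (g / (16 * C1)) := by linarith only [hlam2, hlamg]
    have h2 : C1 * l ≤ C1 * (2 * (g / (16 * C1))) := mul_le_mul_of_nonneg_left h1 hC1pos.le
    have e : C1 * (2 * (g / (16 * C1))) = g / 8 := by field_simp; ring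
    linarith only [h2, e]
  have hs3 : A * l * x ≤ 1 / 2 := by
    have h1 : A * l * x ≤ A * (2 * lam) * 2 :=
      mul_le_mul (mul_le_mul_of_nonneg_left hlam2 hA0) hx2 hxpos.le (mul_nonneg hA0 (by linarith only [hlam]))
    have h2 : A * (2 * lam) * 2 = 4 * A * lam := by ring
    have h3 : 4 * A * lam ≤ 4 * A * (1 / (8 * (A + 1))) :=
      mul_le_mul_of_nonneg_left hlamA (mul_nonneg (by norm_num) hA0)
    have hA1 : 0 < 8 * (A + 1) := by linarith only [hA0]
    have h4 : 4 * A * (1 / (8 * (A + 1))) ≤ 1 / 2 := by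
      rw [show (4 : ℝ) * A * (1 / (8 * (A + 1))) = (4 * A) / (8 * (A + 1)) by ring, div_le_iff₀ hA1]
      linarith only [hA0]
    linarith only [h1, h2, h3, h4]
  -- assemble through the enclosure algebra at `j = k` (Fin index `⟨k, hkk'1⟩`) and the shell end `k'` (`Fin.last k'`)
  obtain ⟨hia, hib⟩ := hratio' ⟨k, hkk'1⟩
  obtain ⟨_, hibk⟩ := hratio' (Fin.last k')
  have honek := hlowj k hkk'
  have honek' := hlowj k' le_rfl
  rw [hbl] at honek honek'
  have hθ' : θ = Real.exp (-((Dk + g / 2) * x)) * levelValue su2Rep L β 0 := by rw [hθdef, e_d]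
  have key := enclosure (lam0v := levelValue su2Rep L β 0) (lamj := levelValue su2Rep L β k)
    (m0 := m0) (mj := qform su2Rep β (φ ⟨k, hkk'1⟩) (φ ⟨k, hkk'1⟩)) (mk := mk)
    (mu0 := levelValue su2Rep 1 B 0) (muj := levelValue su2Rep 1 B k) (muk := levelValue su2Rep 1 B k')
    (θ := θ) (ρ := ρ) (x := x) (l := l) (C1 := C1) (g := g) (Dk := Dk) (Dj := levelGap k) (A := A) (E := E) (Cf := Cf)
    hl0 hmu0 hxpos hx2 hlpos hC1 hg hDk0 (levelGap_mono hkk') hAdef hEdef hCfdef hs1 hs3 hθ' hρdef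
    (fun hlt => hdoor hlt ⟨k, hkk'1⟩) hdoor0 hcap' hm0le (hritzle ⟨k, hkk'1⟩) hia hib hibk honek honek'
  have e_goal : Cf * l ^ 2 / (L : ℝ) = Cf * (l * x) := by rw [hxdef]; ring
  rw [e_goal]
  exact key

end Summit.QuantumFields.YangMills.Theorems.FemtoTransferGap.TraceDoor

end
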